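import Literature.NumberTheory.Sieve.GreenTao2006EnvelopingSieve
import Literature.NumberTheory.Sieve.LargeSieveMultidim
import HarnessLib

/-!
# Green–Tao (2006): the Fourier expansion of the enveloping sieve `β_R` (after Ramaré–Ruzsa)

B. Green, T. Tao, *Restriction theory of the Selberg sieve, with applications*, JTNB **18** (2006)
[GreenTao2006Restriction], Prop. 3.1 (iii) and Appendix Prop. 7.1: the enveloping sieve has a
finite Fourier expansion `β_R(n) = ∑_{q ≤ R²} ∑_{a ∈ ℤ_q^*} w(a/q) e(-an/q)` with
`|w(a/q)| ≤ 3^{ω(q)} h(q)` (`≪_ε q^{ε-1}`).  Second layer of the proof of the named fact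
`Literature.NumberTheory.Sieve.GreenTao2006_envelopingSieve_extension`; everything is PROVED.

## The expansion proved here (tensor form)

Frequencies are indexed by residue vectors `c = (c_p)_{p ≤ R}` with `0 ≤ c_p < p`
(`freqs R`, a `Fintype.piFinset`); the frequency is `θ(c) = ∑_p c_p/p` (`freqVal`), its
denominator is `q(c) = ∏_{p : c_p ≠ 0} p` (`freqDen`, squarefree).  Writing
`β_R = G⁻¹ ∑_{S,S'} ∏_{p ∈ S} u_p ∏_{p ∈ S'} u_p` and expanding each local factor
(`u_p`, `u_p²` or `1`) on `ℤ/pℤ` gives (`betaR_eq_sum_betaCoeff`)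

  `β_R(n) = ∑_{c ∈ freqs R} w(c) e(θ(c) n)`,  `w(c) = G⁻¹ ∑_{S,S'} ∏_p v̂^{S,S'}_p(c_p)` (`betaCoeff`).

Properties: `w(c) = 0` unless `q(c) ≤ R²` (`betaCoeff_eq_zero_of_lt`); `θ(c) = a/q(c)` with
`a ∈ ℤ` (`exists_freqVal_eq_div`); distinct `c` give frequencies distinct mod `1`
(`freqVal_sub_ne_intCast`); and the **coefficient bound** (`norm_betaCoeff_le`, GT (7.19) with
`8^{ω(q)}` in place of `3^{ω(q)}`)

  `|w(c)| ≤ 8^{ω(q)} ∏_{p ∣ q} h_p`,   hence `≤ (32 k²)^{ω(q)} / q` (`norm_betaCoeff_le_div`).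

The proof of the bound is not GT's Lemma 7.6 but the following count: the `(S,S')`-summand
vanishes unless `S △ S' ⊆ D ⊆ S ∪ S'` (`D = supp c`), is then `≤ 2^{|D|} h(D) h((S∩S')∖D)`
(`û_p(0) = 0`, `|û_p| ≤ 2h_p`, `|(u_p²)^| ≤ h_p`), and for fixed `T = (S∩S')∖D` there are at most
`4^{|D|}` such pairs while `∑_T h(T) ≤ G(R)`.

## References

* [GreenTao2006Restriction] Green–Tao, JTNB 18 (2006), Prop. 3.1 (iii)–(iv), Prop. 7.1,
  Lemma 7.3, (7.15)–(7.19) (arXiv:math/0405581).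
* O. Ramaré, I. Z. Ruzsa, JTNB 13 (2001) 559–581, §4.
-/

noncomputable section

open Finset Real Complex
open scoped FourierTransform ComplexConjugate

namespace Literature.NumberTheory.Sieve

namespace GreenTao2006

open LargeSieve (e e_add e_int norm_e conj_e e_zero e_eq_exp)

variable (H : Finset ℤ)

/-! ### Frequencies: residue vectors indexed by the primes `≤ R` -/

/-- The frequency space: residue vectors `c = (c_p)_{p ≤ R, p prime}` with `0 ≤ c_p < p`.
[folklore] -/
def freqs (R : ℕ) : Finset (Nat.primesLE R → ℕ) :=
  Fintype.piFinset fun p : Nat.primesLE R => range (p : ℕ)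

/-- Extension by zero of a residue vector to all naturals. [folklore] -/
def extend {R : ℕ} (c : Nat.primesLE R → ℕ) (p : ℕ) : ℕ :=
  if h : p ∈ Nat.primesLE R then c ⟨p, h⟩ else 0

/-- The frequency `θ(c) = ∑_{p ≤ R} c_p / p ∈ [0, ∞)` of a residue vector. [folklore] -/
def freqVal {R : ℕ} (c : Nat.primesLE R → ℕ) : ℝ :=
  ∑ p ∈ Nat.primesLE R, (extend c p : ℝ) / p

/-- The support `D(c) = {p : c_p ≠ 0}` of a residue vector. [folklore] -/
def freqSupp {R : ℕ} (c : Nat.primesLE R → ℕ) : Finset ℕ :=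
  (Nat.primesLE R).filter (fun p => extend c p ≠ 0)

/-- The (exact, squarefree) denominator `q(c) = ∏_{p ∈ D(c)} p` of `θ(c)`. [folklore] -/
def freqDen {R : ℕ} (c : Nat.primesLE R → ℕ) : ℕ :=
  ∏ p ∈ freqSupp c, p

/-- The local Fourier coefficient at `p` of the `(S, S')`-summand of `β_R`: that of `u_p²` if
`p ∈ S ∩ S'`, of `u_p` if `p ∈ S △ S'`, and of the constant `1` otherwise.
[cite: GreenTao2006Restriction, proof of Prop. 7.1] -/
def vHat (S S' : Finset ℕ) (p : ℕ) (c : ℕ) : ℂ :=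
  if p ∈ S ∧ p ∈ S' then dftCoeff p (fun n => ((localU H p n ^ 2 : ℝ) : ℂ)) c
  else if p ∈ S ∨ p ∈ S' then dftCoeff p (fun n => (localU H p n : ℂ)) c
  else if c = 0 then 1 else 0

/-- The local factor at `p` of the `(S, S')`-summand of `G · β_R = α_R²`. [folklore] -/
def vFun (S S' : Finset ℕ) (p : ℕ) (n : ℤ) : ℂ :=
  (if p ∈ S then (localU H p n : ℂ) else 1) * (if p ∈ S' then (localU H p n : ℂ) else 1)

/-- The Fourier coefficient `w(c)` of `β_R` at the frequency `θ(c)`: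
`w(c) = G(R)⁻¹ ∑_{S, S' ∈ levelSets R} ∏_p v̂^{S,S'}_p(c_p)`.
[cite: GreenTao2006Restriction, Prop. 3.1 (iii) and Prop. 7.1] -/
def betaCoeff (R : ℕ) (c : Nat.primesLE R → ℕ) : ℂ :=
  ((selbergG H R : ℝ) : ℂ)⁻¹ *
    ∑ S ∈ levelSets R, ∑ S' ∈ levelSets R, ∏ p : Nat.primesLE R, vHat H S S' p (c p)

variable {H}

/-! ### Elementary properties of frequencies -/

/-- `extend c p = c p` on the primes `≤ R`. [folklore] -/
theorem extend_apply_coe {R : ℕ} (c : Nat.primesLE R → ℕ) (p : Nat.primesLE R) :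
    extend c p = c p := by
  simp [extend, p.2]

/-- `extend c p = 0` off the primes `≤ R`. [folklore] -/
theorem extend_of_not_mem {R : ℕ} (c : Nat.primesLE R → ℕ) {p : ℕ} (hp : p ∉ Nat.primesLE R) :
    extend c p = 0 := by
  simp [extend, hp]

/-- Membership in `freqs R`: `c_p < p` for all `p`. [folklore] -/
theorem mem_freqs {R : ℕ} {c : Nat.primesLE R → ℕ} :
    c ∈ freqs R ↔ ∀ p : Nat.primesLE R, c p < (p : ℕ) := by
  simp [freqs, Fintype.mem_piFinset]

/-- `extend c p < p` for `c ∈ freqs R` and `p ≤ R` prime. [folklore] -/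
theorem extend_lt_of_mem_freqs {R : ℕ} {c : Nat.primesLE R → ℕ} (hc : c ∈ freqs R) {p : ℕ}
    (hp : p ∈ Nat.primesLE R) : extend c p < p := by
  rw [mem_freqs] at hc
  have := hc ⟨p, hp⟩
  rwa [← extend_apply_coe c ⟨p, hp⟩] at this

/-- Membership in the support `D(c)`. [folklore] -/
theorem mem_freqSupp {R : ℕ} {c : Nat.primesLE R → ℕ} {p : ℕ} :
    p ∈ freqSupp c ↔ p ∈ Nat.primesLE R ∧ extend c p ≠ 0 := by
  simp [freqSupp]

/-- `D(c) ⊆ {p ≤ R prime}`. [folklore] -/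
theorem freqSupp_subset {R : ℕ} (c : Nat.primesLE R → ℕ) : freqSupp c ⊆ Nat.primesLE R :=
  Finset.filter_subset _ _

/-- Elements of `D(c)` are prime. [folklore] -/
theorem prime_of_mem_freqSupp {R : ℕ} {c : Nat.primesLE R → ℕ} {p : ℕ} (hp : p ∈ freqSupp c) :
    p.Prime :=
  Nat.prime_of_mem_primesLE (freqSupp_subset c hp)

/-- `q(c) ≥ 1`. [folklore] -/
theorem freqDen_pos {R : ℕ} (c : Nat.primesLE R → ℕ) : 0 < freqDen c :=
  Finset.prod_pos fun _ hp => (prime_of_mem_freqSupp hp).pos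

/-- `q(c) ≥ 1`. [folklore] -/
theorem one_le_freqDen {R : ℕ} (c : Nat.primesLE R → ℕ) : 1 ≤ freqDen c := freqDen_pos c

/-- `q(c)` is squarefree (a product of distinct primes; cf. the tree's
`FriedlanderIwaniecPrimesSquarefree.squarefree_prod_of_primes`, reproved here to keep the import
closure small). [folklore] -/
theorem squarefree_freqDen {R : ℕ} (c : Nat.primesLE R → ℕ) : Squarefree (freqDen c) := by
  classical
  unfold freqDen
  have key : ∀ s : Finset ℕ, (∀ p ∈ s, p.Prime) → Squarefree (∏ p ∈ s, p) := by
    intro s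
    induction s using Finset.induction_on with
    | empty => intro _; simp
    | insert a s ha ih =>
      intro hs
      rw [Finset.prod_insert ha]
      have hap : a.Prime := hs a (Finset.mem_insert_self a s)
      have hs' : ∀ p ∈ s, p.Prime := fun p hp => hs p (Finset.mem_insert_of_mem hp)
      have hcop : a.Coprime (∏ p ∈ s, p) := by
        refine Nat.Coprime.prod_right fun p hp => (Nat.coprime_primes hap (hs' p hp)).2 ?_
        rintro rfl; exact ha hp
      exact (Nat.squarefree_mul hcop).2 ⟨hap.squarefree, ih hs'⟩
  exact key _ fun _ hp => prime_of_mem_freqSupp hp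

/-- `ω(q(c)) = |D(c)|`: the prime factors of `q(c)` are `D(c)`. [folklore] -/
theorem primeFactors_freqDen {R : ℕ} (c : Nat.primesLE R → ℕ) :
    (freqDen c).primeFactors = freqSupp c :=
  Nat.primeFactors_prod fun _ hp => prime_of_mem_freqSupp hp

/-- `θ(c) = a / q(c)` for a natural number `a`. [folklore] -/
theorem exists_freqVal_eq_div {R : ℕ} (c : Nat.primesLE R → ℕ) :
    ∃ a : ℕ, freqVal c = a / freqDen c := by
  classical
  set D := freqSupp c with hD
  refine ⟨∑ p ∈ D, extend c p * ∏ p' ∈ D.erase p, p', ?_⟩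
  have hq : (freqDen c : ℝ) ≠ 0 := by exact_mod_cast (freqDen_pos c).ne'
  have h1 : freqVal c = ∑ p ∈ D, (extend c p : ℝ) / p := by
    unfold freqVal
    refine (Finset.sum_subset (freqSupp_subset c) fun p hp hpD => ?_).symm
    have : extend c p = 0 := by
      by_contra h
      exact hpD (mem_freqSupp.2 ⟨hp, h⟩)
    rw [this, Nat.cast_zero, zero_div]
  rw [h1, eq_div_iff hq, Finset.sum_mul]
  push_cast
  refine Finset.sum_congr rfl fun p hp => ?_
  have hp0 : (p : ℝ) ≠ 0 := by exact_mod_cast (prime_of_mem_freqSupp hp).ne_zero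
  have hmul : (freqDen c : ℝ) = p * ∏ p' ∈ D.erase p, (p' : ℝ) := by
    have h := Finset.mul_prod_erase D (fun x => x) hp
    unfold freqDen
    rw [← hD, ← h]
    push_cast
    ring
  rw [hmul]
  field_simp

/-- `0 ≤ θ(c)`. [folklore] -/
theorem freqVal_nonneg {R : ℕ} (c : Nat.primesLE R → ℕ) : 0 ≤ freqVal c :=
  Finset.sum_nonneg fun _ _ => by positivity

/-- **Distinct residue vectors give frequencies that are distinct modulo `1`.**  If
`∑_p (c_p - c'_p)/p ∈ ℤ` then, multiplying by `P = ∏_{p ≤ R} p` and reducing mod `p₀`,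
`p₀ ∣ c_{p₀} - c'_{p₀}`, so `c_{p₀} = c'_{p₀}` as both lie in `[0, p₀)`. [folklore] -/
theorem freqVal_sub_ne_intCast {R : ℕ} {c c' : Nat.primesLE R → ℕ} (hc : c ∈ freqs R)
    (hc' : c' ∈ freqs R) (hne : c ≠ c') (m : ℤ) : freqVal c - freqVal c' ≠ m := by
  classical
  intro heq
  obtain ⟨p₀, hp₀⟩ : ∃ p₀ : Nat.primesLE R, c p₀ ≠ c' p₀ := by
    by_contra h
    push Not at h
    exact hne (funext h)
  have hp₀P : (p₀ : ℕ) ∈ Nat.primesLE R := p₀.2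
  have hprime : ∀ p ∈ Nat.primesLE R, p.Prime := fun p hp => Nat.prime_of_mem_primesLE hp
  -- the cofactors `cof p = P/p`, `P = ∏_{p ≤ R} p`
  have hcof_mul : ∀ p ∈ Nat.primesLE R,
      (p : ℝ) * ((∏ p' ∈ (Nat.primesLE R).erase p, p' : ℕ) : ℝ) =
        ∏ p' ∈ Nat.primesLE R, (p' : ℝ) := by
    intro p hp
    push_cast
    exact Finset.mul_prod_erase (Nat.primesLE R) (fun x => (x : ℝ)) hp
  -- the difference vector, in `ℤ`
  set d : ℕ → ℤ := fun p => (extend c p : ℤ) - extend c' p with hd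
  -- integer identity: `∑_p d_p cof p = m ∏ P`
  have hreal : (∑ p ∈ Nat.primesLE R,
      (d p : ℝ) * ((∏ p' ∈ (Nat.primesLE R).erase p, p' : ℕ) : ℝ)) =
        (m : ℝ) * ∏ p' ∈ Nat.primesLE R, (p' : ℝ) := by
    have h1 : freqVal c - freqVal c' = ∑ p ∈ Nat.primesLE R, (d p : ℝ) / p := by
      unfold freqVal
      rw [← Finset.sum_sub_distrib]
      refine Finset.sum_congr rfl fun p _ => ?_
      rw [hd]
      push_cast
      ring
    rw [h1] at heq
    calc ∑ p ∈ Nat.primesLE R, (d p : ℝ) * ((∏ p' ∈ (Nat.primesLE R).erase p, p' : ℕ) : ℝ)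
        = ∑ p ∈ Nat.primesLE R, (d p : ℝ) / p * ∏ p' ∈ Nat.primesLE R, (p' : ℝ) := by
          refine Finset.sum_congr rfl fun p hp => ?_
          have hp0 : (p : ℝ) ≠ 0 := by exact_mod_cast (hprime p hp).ne_zero
          rw [← hcof_mul p hp]
          field_simp
      _ = (m : ℝ) * ∏ p' ∈ Nat.primesLE R, (p' : ℝ) := by rw [← Finset.sum_mul, heq]
  have hint : ∑ p ∈ Nat.primesLE R, d p * ((∏ p' ∈ (Nat.primesLE R).erase p, p' : ℕ) : ℤ) =
      m * ∏ p' ∈ Nat.primesLE R, (p' : ℤ) := by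
    have h : ((∑ p ∈ Nat.primesLE R, d p * ((∏ p' ∈ (Nat.primesLE R).erase p, p' : ℕ) : ℤ) :
        ℤ) : ℝ) = ((m * ∏ p' ∈ Nat.primesLE R, (p' : ℤ) : ℤ) : ℝ) := by
      push_cast
      push_cast at hreal
      exact hreal
    exact Int.cast_inj.1 h
  -- reduce modulo `p₀`
  have hp₀prime : (p₀ : ℕ).Prime := hprime _ hp₀P
  have hdvd_cof : ∀ p ∈ Nat.primesLE R, p ≠ (p₀ : ℕ) →
      ((p₀ : ℕ) : ℤ) ∣ ((∏ p' ∈ (Nat.primesLE R).erase p, p' : ℕ) : ℤ) := by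
    intro p _ hne'
    push_cast
    exact Finset.dvd_prod_of_mem (fun x : ℕ => (x : ℤ)) (Finset.mem_erase.2 ⟨hne'.symm, hp₀P⟩)
  have hdvdP : ((p₀ : ℕ) : ℤ) ∣ ∏ p' ∈ Nat.primesLE R, (p' : ℤ) :=
    Finset.dvd_prod_of_mem (fun x : ℕ => (x : ℤ)) hp₀P
  have hkey : ((p₀ : ℕ) : ℤ) ∣
      d p₀ * ((∏ p' ∈ (Nat.primesLE R).erase p₀, p' : ℕ) : ℤ) := by
    have hsplit := Finset.add_sum_erase (Nat.primesLE R)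
      (fun p => d p * ((∏ p' ∈ (Nat.primesLE R).erase p, p' : ℕ) : ℤ)) hp₀P
    rw [hint] at hsplit
    have hrest : ((p₀ : ℕ) : ℤ) ∣ ∑ p ∈ (Nat.primesLE R).erase p₀,
        d p * ((∏ p' ∈ (Nat.primesLE R).erase p, p' : ℕ) : ℤ) := by
      refine Finset.dvd_sum fun p hp => ?_
      rw [Finset.mem_erase] at hp
      exact Dvd.dvd.mul_left (hdvd_cof p hp.2 hp.1) _
    have := dvd_sub (hdvdP.mul_left m) hrest
    rw [← hsplit, add_sub_cancel_right] at this
    exact this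
  have hcop : Nat.Coprime (p₀ : ℕ) (∏ p' ∈ (Nat.primesLE R).erase p₀, p') := by
    refine Nat.Coprime.prod_right fun p hp => ?_
    rw [Finset.mem_erase] at hp
    exact (Nat.coprime_primes hp₀prime (hprime p hp.2)).2 (Ne.symm hp.1)
  have hdvd0 : ((p₀ : ℕ) : ℤ) ∣ d p₀ :=
    Int.dvd_of_dvd_mul_left_of_gcd_one hkey (by
      rw [Int.gcd_natCast_natCast]; exact hcop)
  -- `|c_{p₀} - c'_{p₀}| < p₀`
  have hlt1 : extend c p₀ < (p₀ : ℕ) := extend_lt_of_mem_freqs hc hp₀P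
  have hlt2 : extend c' p₀ < (p₀ : ℕ) := extend_lt_of_mem_freqs hc' hp₀P
  have habs : |d p₀| < (p₀ : ℕ) := by
    rw [hd, abs_lt]; constructor <;> push_cast <;> omega
  have h0 := Int.eq_zero_of_abs_lt_dvd hdvd0 habs
  have : extend c p₀ = extend c' p₀ := by rw [hd] at h0; simp only at h0; omega
  rw [extend_apply_coe, extend_apply_coe] at this
  exact hp₀ this


/-! ### The expansion `β_R(n) = ∑_c w(c) e(θ(c) n)` -/

/-- Local Fourier expansion of the `(S,S')`-factor at `p`:
`v_p(n) = ∑_{c<p} v̂_p(c) e(cn/p)`. [folklore] -/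
theorem vFun_eq_sum {p : ℕ} (hp : 0 < p) (S S' : Finset ℕ) (n : ℤ) :
    vFun H S S' p n = ∑ c ∈ range p, vHat H S S' p c * e ((c : ℝ) * n / p) := by
  unfold vFun vHat
  by_cases hS : p ∈ S <;> by_cases hS' : p ∈ S'
  · simp only [hS, hS', if_true, and_self]
    rw [← localU_sq_eq_sum_dftCoeff hp]
    push_cast
    ring
  · simp only [hS, hS', if_true, if_false, and_false, true_or, mul_one]
    exact localU_eq_sum_dftCoeff hp n
  · simp only [hS, hS', if_true, if_false, false_and, or_true, one_mul]
    exact localU_eq_sum_dftCoeff hp n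
  · simp only [hS, hS', if_false, false_and, false_or, mul_one]
    simp_rw [ite_mul, one_mul, zero_mul]
    rw [Finset.sum_ite_eq' (range p) 0 (fun c => e ((c : ℝ) * n / p)), if_pos (by simpa using hp)]
    simp [e_zero]

/-- `∏_{p ≤ R} v_p(n) = ∏_{p ∈ S} u_p(n) · ∏_{p ∈ S'} u_p(n)` for `S, S' ⊆ {p ≤ R}`. [folklore] -/
theorem prod_vFun {R : ℕ} {S S' : Finset ℕ} (hS : S ⊆ Nat.primesLE R) (hS' : S' ⊆ Nat.primesLE R)
    (n : ℤ) :
    ∏ p : Nat.primesLE R, vFun H S S' p n =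
      (∏ p ∈ S, (localU H p n : ℂ)) * ∏ p ∈ S', (localU H p n : ℂ) := by
  rw [Finset.prod_coe_sort (Nat.primesLE R) (fun p => vFun H S S' p n)]
  unfold vFun
  rw [Finset.prod_mul_distrib, Finset.prod_ite_mem, Finset.prod_ite_mem,
    Finset.inter_eq_right.2 hS, Finset.inter_eq_right.2 hS']

/-- Tensor expansion of one summand:
`∏_{p∈S} u_p(n) ∏_{p∈S'} u_p(n) = ∑_{c} (∏_p v̂_p(c_p)) e(θ(c) n)`.
[cite: GreenTao2006Restriction, proof of Prop. 7.1] -/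
theorem prod_localU_mul_prod_eq_sum {R : ℕ} {S S' : Finset ℕ} (hS : S ⊆ Nat.primesLE R)
    (hS' : S' ⊆ Nat.primesLE R) (n : ℤ) :
    (∏ p ∈ S, (localU H p n : ℂ)) * ∏ p ∈ S', (localU H p n : ℂ) =
      ∑ c ∈ freqs R, (∏ p : Nat.primesLE R, vHat H S S' p (c p)) * e (freqVal c * n) := by
  classical
  rw [← prod_vFun hS hS' n]
  have hloc : ∀ p : Nat.primesLE R, vFun H S S' p n =
      ∑ c ∈ range (p : ℕ), vHat H S S' p c * e ((c : ℝ) * n / (p : ℕ)) :=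
    fun p => vFun_eq_sum (Nat.prime_of_mem_primesLE p.2).pos S S' n
  rw [Finset.prod_congr rfl (fun p _ => hloc p)]
  rw [Finset.prod_univ_sum]
  unfold freqs
  refine Finset.sum_congr rfl fun c _ => ?_
  rw [Finset.prod_mul_distrib]
  congr 1
  rw [← LargeSieve.e_finset_sum]
  congr 1
  unfold freqVal
  rw [Finset.sum_mul, ← Finset.sum_coe_sort (Nat.primesLE R)]
  refine Finset.sum_congr rfl fun p _ => ?_
  rw [extend_apply_coe]
  ring

/-- **The Fourier expansion of the enveloping sieve** (GT Prop. 3.1 (iii) / Prop. 7.1, tensor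
form): `β_R(n) = ∑_{c ∈ freqs R} w(c) e(θ(c) n)` for every integer `n`.
[cite: GreenTao2006Restriction, Prop. 3.1 (iii) and Prop. 7.1] -/
theorem betaR_eq_sum_betaCoeff {R : ℕ} (n : ℤ) :
    (betaR H R n : ℂ) = ∑ c ∈ freqs R, betaCoeff H R c * e (freqVal c * n) := by
  classical
  have hsub : ∀ S ∈ levelSets R, S ⊆ Nat.primesLE R := fun S hS => (mem_levelSets.1 hS).1
  unfold betaR betaCoeff alphaR
  push_cast
  rw [div_eq_inv_mul, sq, Finset.sum_mul_sum]
  have hexp : ∑ S ∈ levelSets R, ∑ S' ∈ levelSets R,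
      (∏ p ∈ S, (localU H p n : ℂ)) * ∏ p ∈ S', (localU H p n : ℂ) =
      ∑ S ∈ levelSets R, ∑ S' ∈ levelSets R, ∑ c ∈ freqs R,
        (∏ p : Nat.primesLE R, vHat H S S' p (c p)) * e (freqVal c * n) := by
    refine Finset.sum_congr rfl fun S hS => Finset.sum_congr rfl fun S' hS' => ?_
    exact prod_localU_mul_prod_eq_sum (hsub S hS) (hsub S' hS') n
  rw [hexp]
  have hswap : ∑ S ∈ levelSets R, ∑ S' ∈ levelSets R, ∑ c ∈ freqs R,
      (∏ p : Nat.primesLE R, vHat H S S' p (c p)) * e (freqVal c * n) =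
      ∑ c ∈ freqs R, ∑ S ∈ levelSets R, ∑ S' ∈ levelSets R,
        (∏ p : Nat.primesLE R, vHat H S S' p (c p)) * e (freqVal c * n) := by
    calc _ = ∑ S ∈ levelSets R, ∑ c ∈ freqs R, ∑ S' ∈ levelSets R,
          (∏ p : Nat.primesLE R, vHat H S S' p (c p)) * e (freqVal c * n) :=
          Finset.sum_congr rfl fun S _ => Finset.sum_comm
      _ = _ := Finset.sum_comm
  rw [hswap, Finset.mul_sum]
  refine Finset.sum_congr rfl fun c _ => ?_
  rw [mul_assoc, Finset.sum_mul]
  congr 1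
  refine Finset.sum_congr rfl fun S _ => ?_
  rw [Finset.sum_mul]

/-! ### Support: `w(c) = 0` unless `q(c) ≤ R²` -/

/-- If some `c_p ≠ 0` with `p ∉ S ∪ S'`, the `(S,S')`-product vanishes. [folklore] -/
theorem prod_vHat_eq_zero {R : ℕ} {S S' : Finset ℕ} {c : Nat.primesLE R → ℕ}
    (p : Nat.primesLE R) (hpS : (p : ℕ) ∉ S) (hpS' : (p : ℕ) ∉ S') (hc : c p ≠ 0) :
    ∏ p : Nat.primesLE R, vHat H S S' p (c p) = 0 := by
  refine Finset.prod_eq_zero (Finset.mem_univ p) ?_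
  simp [vHat, hpS, hpS', hc]

/-- If the `(S,S')`-product at `c` is nonzero then `D(c) ⊆ S ∪ S'`. [folklore] -/
theorem freqSupp_subset_union {R : ℕ} {S S' : Finset ℕ} {c : Nat.primesLE R → ℕ}
    (h : ∏ p : Nat.primesLE R, vHat H S S' p (c p) ≠ 0) : freqSupp c ⊆ S ∪ S' := by
  intro p hp
  rw [mem_freqSupp] at hp
  by_contra hmem
  rw [Finset.mem_union, not_or] at hmem
  refine h (prod_vHat_eq_zero ⟨p, hp.1⟩ hmem.1 hmem.2 ?_)
  rw [← extend_apply_coe c ⟨p, hp.1⟩]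
  exact hp.2

/-- `∏_{p ∈ S ∪ S'} p ≤ (∏_{p ∈ S} p)(∏_{p ∈ S'} p)` for sets of positive integers. [folklore] -/
theorem prod_union_le_mul {S S' : Finset ℕ} (h : ∀ p ∈ S ∪ S', 1 ≤ p) :
    ∏ p ∈ S ∪ S', p ≤ (∏ p ∈ S, p) * ∏ p ∈ S', p := by
  classical
  rw [← Finset.prod_union_inter]
  refine Nat.le_mul_of_pos_right _ (Finset.prod_pos fun p hp => h p ?_)
  exact Finset.mem_union_left _ (Finset.mem_inter.1 hp).1

/-- If the `(S,S')`-product at `c` is nonzero (with `S, S' ∈ levelSets R`) then `q(c) ≤ R²`.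
[cite: GreenTao2006Restriction, proof of Prop. 7.1 ("since `[r_1,r_2] ≤ R²`")] -/
theorem freqDen_le_of_prod_ne_zero {R : ℕ} {S S' : Finset ℕ} (hS : S ∈ levelSets R)
    (hS' : S' ∈ levelSets R) {c : Nat.primesLE R → ℕ}
    (h : ∏ p : Nat.primesLE R, vHat H S S' p (c p) ≠ 0) : freqDen c ≤ R ^ 2 := by
  have hsub := freqSupp_subset_union h
  have h1 : ∀ p ∈ S ∪ S', 1 ≤ p := by
    intro p hp
    rcases Finset.mem_union.1 hp with hp | hp
    · exact (prime_of_mem_of_mem_levelSets hS hp).one_le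
    · exact (prime_of_mem_of_mem_levelSets hS' hp).one_le
  calc freqDen c ≤ ∏ p ∈ S ∪ S', p :=
        Finset.prod_le_prod_of_subset_of_one_le' hsub fun p hp _ => h1 p hp
    _ ≤ (∏ p ∈ S, p) * ∏ p ∈ S', p := prod_union_le_mul h1
    _ ≤ R * R := Nat.mul_le_mul (mem_levelSets.1 hS).2 (mem_levelSets.1 hS').2
    _ = R ^ 2 := (sq R).symm

/-- `w(c) = 0` unless `q(c) ≤ R²`. [cite: GreenTao2006Restriction, Prop. 3.1 (iii)] -/
theorem betaCoeff_eq_zero_of_lt {R : ℕ} {c : Nat.primesLE R → ℕ} (hc : R ^ 2 < freqDen c) :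
    betaCoeff H R c = 0 := by
  unfold betaCoeff
  rw [Finset.sum_eq_zero, mul_zero]
  intro S hS
  refine Finset.sum_eq_zero fun S' hS' => ?_
  by_contra h
  exact absurd (freqDen_le_of_prod_ne_zero hS hS' h) (not_le.2 hc)

/-- The expansion of `β_R` over the frequencies with `q(c) ≤ R²` only.
[cite: GreenTao2006Restriction, Prop. 3.1 (iii)] -/
theorem betaR_eq_sum_filter_betaCoeff {R : ℕ} (n : ℤ) :
    (betaR H R n : ℂ) =
      ∑ c ∈ (freqs R).filter (fun c => freqDen c ≤ R ^ 2), betaCoeff H R c * e (freqVal c * n) := by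
  rw [betaR_eq_sum_betaCoeff, Finset.sum_filter]
  refine Finset.sum_congr rfl fun c _ => ?_
  split_ifs with h
  · rfl
  · rw [betaCoeff_eq_zero_of_lt (not_le.1 h), zero_mul]

/-! ### The coefficient bound `|w(c)| ≤ 8^{|D(c)|} h(D(c))` -/

/-- Norm bound for the `(S,S')`-product at `c`: it vanishes unless
`S △ S' ⊆ D(c) ⊆ S ∪ S'`, and is then at most `2^{|D(c)|} ∏_{p ∈ S ∪ S'} h_p`.
[cite: GreenTao2006Restriction, proof of Prop. 7.1 and Lemma 7.3 (vi)] -/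
theorem norm_prod_vHat_le (hadm : IsAdmissibleTuple H) {R : ℕ} {S S' : Finset ℕ}
    (hS : S ∈ levelSets R) (hS' : S' ∈ levelSets R) (c : Nat.primesLE R → ℕ) :
    ‖∏ p : Nat.primesLE R, vHat H S S' p (c p)‖ ≤
      if (S ∪ S') \ (S ∩ S') ⊆ freqSupp c ∧ freqSupp c ⊆ S ∪ S' then
        2 ^ (freqSupp c).card * ∏ p ∈ S ∪ S', localH H p else 0 := by
  classical
  have hSP : S ⊆ Nat.primesLE R := (mem_levelSets.1 hS).1
  have hS'P : S' ⊆ Nat.primesLE R := (mem_levelSets.1 hS').1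
  split_ifs with hcond
  · -- termwise bounds
    rw [Complex.norm_prod]
    have hconv : ∏ p : Nat.primesLE R, ‖vHat H S S' p (c p)‖ =
        ∏ p ∈ Nat.primesLE R, ‖vHat H S S' p (extend c p)‖ := by
      rw [← Finset.prod_coe_sort (Nat.primesLE R) (fun p => ‖vHat H S S' p (extend c p)‖)]
      refine Finset.prod_congr rfl fun p _ => ?_
      rw [extend_apply_coe]
    rw [hconv]
    set bnd : ℕ → ℝ := fun p =>
      (if p ∈ (S ∪ S') \ (S ∩ S') then (2 : ℝ) else 1) * (if p ∈ S ∪ S' then localH H p else 1)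
      with hbnd
    have hterm : ∀ p ∈ Nat.primesLE R, ‖vHat H S S' p (extend c p)‖ ≤ bnd p := by
      intro p hp
      have hprime := Nat.prime_of_mem_primesLE hp
      have hh0 := localH_nonneg (H := H) hprime.pos
      rw [hbnd]
      simp only [Finset.mem_sdiff, Finset.mem_union, Finset.mem_inter]
      unfold vHat
      by_cases h1 : p ∈ S <;> by_cases h2 : p ∈ S'
      · simp only [h1, h2, and_self, if_true, or_self, not_true, and_false, if_false, one_mul]
        exact norm_dftCoeff_localU_sq_le hadm hprime _
      · simp only [h1, h2, and_false, if_false, true_or, if_true, not_false_eq_true, and_self]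
        exact norm_dftCoeff_localU_le hadm hprime _
      · simp only [h1, h2, false_and, if_false, or_true, if_true, not_false_eq_true, and_self]
        exact norm_dftCoeff_localU_le hadm hprime _
      · simp only [h1, h2, false_and, if_false, or_self, false_and, one_mul]
        have hc0 : extend c p = 0 := by
          by_contra hne
          have := hcond.2 (mem_freqSupp.2 ⟨hp, hne⟩)
          rw [Finset.mem_union] at this
          tauto
        rw [hc0]
        simp
    refine (Finset.prod_le_prod (fun p _ => norm_nonneg _) hterm).trans ?_
    rw [hbnd, Finset.prod_mul_distrib, Finset.prod_ite_mem, Finset.prod_ite_mem,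
      Finset.prod_const, Finset.inter_eq_right.2 (Finset.union_subset hSP hS'P),
      Finset.inter_eq_right.2 (Finset.sdiff_subset.trans (Finset.union_subset hSP hS'P))]
    refine mul_le_mul_of_nonneg_right ?_ (Finset.prod_nonneg fun p hp => localH_nonneg ?_)
    · exact pow_le_pow_right₀ (by norm_num) (Finset.card_le_card hcond.1)
    · rcases Finset.mem_union.1 hp with hp | hp
      · exact (prime_of_mem_of_mem_levelSets hS hp).pos
      · exact (prime_of_mem_of_mem_levelSets hS' hp).pos
  · -- some factor vanishes
    refine le_of_eq (norm_eq_zero.2 ?_)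
    rw [not_and_or, Finset.not_subset, Finset.not_subset] at hcond
    rcases hcond with ⟨p, hp, hpD⟩ | ⟨p, hpD, hp⟩
    · rw [Finset.mem_sdiff, Finset.mem_union, Finset.mem_inter] at hp
      have hpP : p ∈ Nat.primesLE R := by
        rcases hp.1 with h | h
        · exact hSP h
        · exact hS'P h
      have hc0 : c ⟨p, hpP⟩ = 0 := by
        by_contra hne
        refine hpD (mem_freqSupp.2 ⟨hpP, ?_⟩)
        rwa [extend_apply_coe c ⟨p, hpP⟩]
      refine Finset.prod_eq_zero (Finset.mem_univ ⟨p, hpP⟩) ?_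
      have hprime := Nat.prime_of_mem_primesLE hpP
      simp only [vHat, hc0]
      rw [if_neg (by tauto), if_pos hp.1]
      exact dftCoeff_localU_zero hadm hprime
    · rw [mem_freqSupp] at hpD
      rw [Finset.mem_union, not_or] at hp
      refine prod_vHat_eq_zero ⟨p, hpD.1⟩ hp.1 hp.2 ?_
      rw [← extend_apply_coe c ⟨p, hpD.1⟩]
      exact hpD.2


/-- Under `S △ S' ⊆ D ⊆ S ∪ S'`: `S ∪ S' = D ⊔ ((S ∩ S') ∖ D)`, hence
`h(S ∪ S') = h(D) · h((S ∩ S') ∖ D)`. [folklore] -/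
theorem prod_union_eq_of_cond {S S' D : Finset ℕ} (h1 : (S ∪ S') \ (S ∩ S') ⊆ D)
    (h2 : D ⊆ S ∪ S') (f : ℕ → ℝ) :
    ∏ p ∈ S ∪ S', f p = (∏ p ∈ D, f p) * ∏ p ∈ (S ∩ S') \ D, f p := by
  classical
  rw [← Finset.prod_union (Finset.disjoint_sdiff)]
  congr 1
  ext p
  simp only [Finset.mem_union, Finset.mem_sdiff, Finset.mem_inter]
  constructor
  · intro hp
    by_cases hpD : p ∈ D
    · exact Or.inl hpD
    · right
      refine ⟨?_, hpD⟩
      by_contra hboth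
      exact hpD (h1 (by simp only [Finset.mem_sdiff, Finset.mem_union, Finset.mem_inter]; tauto))
  · rintro (hp | ⟨⟨hp, -⟩, -⟩)
    · exact Finset.mem_union.1 (h2 hp)
    · exact Or.inl hp

/-- Under `S △ S' ⊆ D`: `S = (S ∩ D) ∪ ((S ∩ S') ∖ D)` (so `S` is determined by `S ∩ D` and
`(S ∩ S') ∖ D`). [folklore] -/
theorem eq_inter_union_of_cond {S S' D : Finset ℕ} (h1 : (S ∪ S') \ (S ∩ S') ⊆ D) :
    S = (S ∩ D) ∪ ((S ∩ S') \ D) := by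
  ext p
  simp only [Finset.mem_union, Finset.mem_inter, Finset.mem_sdiff]
  constructor
  · intro hp
    by_cases hpD : p ∈ D
    · exact Or.inl ⟨hp, hpD⟩
    · right
      refine ⟨⟨hp, ?_⟩, hpD⟩
      by_contra hS'
      exact hpD (h1 (by simp only [Finset.mem_sdiff, Finset.mem_union, Finset.mem_inter]; tauto))
  · rintro (⟨hp, -⟩ | ⟨⟨hp, -⟩, -⟩) <;> exact hp

/-- The counting step: for fixed `D`, summing `h((S ∩ S') ∖ D)` over the pairs
`(S, S') ∈ levelSets R²` with `S △ S' ⊆ D ⊆ S ∪ S'` gives at most `4^{|D|} G(R)` (each fibre of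
`(S,S') ↦ (S ∩ S') ∖ D` has at most `4^{|D|}` elements). [folklore] -/
theorem sum_pairs_prod_localH_le {R : ℕ} (D : Finset ℕ) :
    ∑ x ∈ ((levelSets R) ×ˢ (levelSets R)).filter
        (fun x => (x.1 ∪ x.2) \ (x.1 ∩ x.2) ⊆ D ∧ D ⊆ x.1 ∪ x.2),
      ∏ p ∈ (x.1 ∩ x.2) \ D, localH H p ≤ 4 ^ D.card * selbergG H R := by
  classical
  set F := ((levelSets R) ×ˢ (levelSets R)).filter
        (fun x => (x.1 ∪ x.2) \ (x.1 ∩ x.2) ⊆ D ∧ D ⊆ x.1 ∪ x.2) with hF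
  set g : Finset ℕ × Finset ℕ → Finset ℕ := fun x => (x.1 ∩ x.2) \ D with hg
  have hmaps : ∀ x ∈ F, g x ∈ levelSets R := by
    intro x hx
    rw [hF, Finset.mem_filter, Finset.mem_product] at hx
    exact subset_mem_levelSets hx.1.1 (Finset.sdiff_subset.trans Finset.inter_subset_left)
  rw [show (∑ x ∈ F, ∏ p ∈ (x.1 ∩ x.2) \ D, localH H p) = ∑ x ∈ F, ∏ p ∈ g x, localH H p
    from rfl, ← Finset.sum_fiberwise_of_maps_to hmaps]
  have hfib : ∀ T ∈ levelSets R,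
      ∑ x ∈ F.filter (fun x => g x = T), ∏ p ∈ g x, localH H p ≤
        4 ^ D.card * ∏ p ∈ T, localH H p := by
    intro T hT
    have heq : ∑ x ∈ F.filter (fun x => g x = T), ∏ p ∈ g x, localH H p =
        ∑ x ∈ F.filter (fun x => g x = T), ∏ p ∈ T, localH H p :=
      Finset.sum_congr rfl fun x hx => by rw [(Finset.mem_filter.1 hx).2]
    rw [heq, Finset.sum_const, nsmul_eq_mul]
    refine mul_le_mul_of_nonneg_right ?_ (prod_localH_nonneg hT)
    -- the fibre injects into `D.powerset × D.powerset`
    have hinj : Set.InjOn (fun x : Finset ℕ × Finset ℕ => (x.1 ∩ D, x.2 ∩ D))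
        ↑(F.filter (fun x => g x = T)) := by
      intro x hx y hy hxy
      simp only [Finset.coe_filter, Set.mem_setOf_eq, hF, Finset.mem_filter,
        Finset.mem_product, hg] at hx hy
      simp only [Prod.mk.injEq] at hxy
      have hx1 := eq_inter_union_of_cond hx.1.2.1
      have hy1 := eq_inter_union_of_cond hy.1.2.1
      have hx2 := eq_inter_union_of_cond (S := x.2) (S' := x.1) (D := D)
        (by rw [Finset.union_comm, Finset.inter_comm]; exact hx.1.2.1)
      have hy2 := eq_inter_union_of_cond (S := y.2) (S' := y.1) (D := D)
        (by rw [Finset.union_comm, Finset.inter_comm]; exact hy.1.2.1)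
      rw [Finset.inter_comm x.2 x.1] at hx2
      rw [Finset.inter_comm y.2 y.1] at hy2
      rw [hx.2] at hx1 hx2
      rw [hy.2] at hy1 hy2
      ext1
      · rw [hx1, hy1, hxy.1]
      · rw [hx2, hy2, hxy.2]
    have hmaps' : Set.MapsTo (fun x : Finset ℕ × Finset ℕ => (x.1 ∩ D, x.2 ∩ D))
        ↑(F.filter (fun x => g x = T)) ↑(D.powerset ×ˢ D.powerset) := by
      intro x _
      simp only [Finset.coe_product, Finset.coe_powerset, Set.mem_prod, Set.mem_preimage,
        Set.mem_powerset_iff, Finset.coe_subset]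
      exact ⟨Finset.inter_subset_right, Finset.inter_subset_right⟩
    have hcard := Finset.card_le_card_of_injOn _ hmaps' hinj
    rw [Finset.card_product, Finset.card_powerset] at hcard
    calc ((F.filter (fun x => g x = T)).card : ℝ) ≤ (2 ^ D.card * 2 ^ D.card : ℕ) := by
          exact_mod_cast hcard
      _ = 4 ^ D.card := by push_cast; rw [← mul_pow]; norm_num
  calc ∑ T ∈ levelSets R, ∑ x ∈ F.filter (fun x => g x = T), ∏ p ∈ g x, localH H p
      ≤ ∑ T ∈ levelSets R, 4 ^ D.card * ∏ p ∈ T, localH H p := Finset.sum_le_sum hfib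
    _ = 4 ^ D.card * selbergG H R := by rw [← Finset.mul_sum]; rfl

/-- **The coefficient bound** (GT Prop. 7.1, (7.19), with `8^{ω(q)}` for `3^{ω(q)}`):
`|w(c)| ≤ 8^{|D(c)|} ∏_{p ∈ D(c)} h_p`. [cite: GreenTao2006Restriction, Prop. 7.1 (7.19)] -/
theorem norm_betaCoeff_le (hadm : IsAdmissibleTuple H) {R : ℕ} (hR : 1 ≤ R)
    (c : Nat.primesLE R → ℕ) :
    ‖betaCoeff H R c‖ ≤ 8 ^ (freqSupp c).card * ∏ p ∈ freqSupp c, localH H p := by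
  classical
  set D := freqSupp c with hD
  have hG := selbergG_pos (H := H) hR
  have hhD : 0 ≤ ∏ p ∈ D, localH H p :=
    Finset.prod_nonneg fun p hp => localH_nonneg (prime_of_mem_freqSupp hp).pos
  unfold betaCoeff
  rw [norm_mul, norm_inv, Complex.norm_real, Real.norm_eq_abs, abs_of_pos hG]
  -- bound the double sum
  have hsum : ‖∑ S ∈ levelSets R, ∑ S' ∈ levelSets R,
      ∏ p : Nat.primesLE R, vHat H S S' p (c p)‖ ≤
      2 ^ D.card * (∏ p ∈ D, localH H p) * (4 ^ D.card * selbergG H R) := by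
    rw [← Finset.sum_product']
    refine (norm_sum_le _ _).trans ?_
    calc ∑ x ∈ levelSets R ×ˢ levelSets R, ‖∏ p : Nat.primesLE R, vHat H x.1 x.2 p (c p)‖
        ≤ ∑ x ∈ levelSets R ×ˢ levelSets R,
            if (x.1 ∪ x.2) \ (x.1 ∩ x.2) ⊆ D ∧ D ⊆ x.1 ∪ x.2 then
              2 ^ D.card * ∏ p ∈ x.1 ∪ x.2, localH H p else 0 := by
          refine Finset.sum_le_sum fun x hx => ?_
          rw [Finset.mem_product] at hx
          exact norm_prod_vHat_le hadm hx.1 hx.2 c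
      _ = ∑ x ∈ (levelSets R ×ˢ levelSets R).filter
            (fun x => (x.1 ∪ x.2) \ (x.1 ∩ x.2) ⊆ D ∧ D ⊆ x.1 ∪ x.2),
            2 ^ D.card * ∏ p ∈ x.1 ∪ x.2, localH H p := (Finset.sum_filter _ _).symm
      _ = ∑ x ∈ (levelSets R ×ˢ levelSets R).filter
            (fun x => (x.1 ∪ x.2) \ (x.1 ∩ x.2) ⊆ D ∧ D ⊆ x.1 ∪ x.2),
            2 ^ D.card * (∏ p ∈ D, localH H p) * ∏ p ∈ (x.1 ∩ x.2) \ D, localH H p := by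
          refine Finset.sum_congr rfl fun x hx => ?_
          rw [Finset.mem_filter] at hx
          rw [prod_union_eq_of_cond hx.2.1 hx.2.2, mul_assoc]
      _ ≤ 2 ^ D.card * (∏ p ∈ D, localH H p) * (4 ^ D.card * selbergG H R) := by
          rw [← Finset.mul_sum]
          exact mul_le_mul_of_nonneg_left (sum_pairs_prod_localH_le D) (by positivity)
  calc (selbergG H R)⁻¹ * ‖∑ S ∈ levelSets R, ∑ S' ∈ levelSets R,
        ∏ p : Nat.primesLE R, vHat H S S' p (c p)‖
      ≤ (selbergG H R)⁻¹ * (2 ^ D.card * (∏ p ∈ D, localH H p) * (4 ^ D.card * selbergG H R)) :=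
        mul_le_mul_of_nonneg_left hsum (inv_nonneg.2 hG.le)
    _ = 8 ^ D.card * ∏ p ∈ D, localH H p := by
        field_simp
        rw [show (8 : ℝ) = 2 * 4 by norm_num, mul_pow]
        ring

/-- `h_p ≤ 4k²/p` at every prime, for an admissible `k`-tuple with `k ≥ 1`
(`ν_p ≤ min(k, p-1)`). [cite: GreenTao2006Restriction, (7.21)] -/
theorem localH_le (hadm : IsAdmissibleTuple H) (hk : 1 ≤ H.card) {p : ℕ} (hp : p.Prime) :
    localH H p ≤ 4 * (H.card : ℝ) ^ 2 / p := by
  have hp0 : (0 : ℝ) < p := by exact_mod_cast hp.pos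
  have hν : (tupleResidueCount H p : ℝ) + 1 ≤ p := by
    have := hadm p hp
    exact_mod_cast this
  have hνk : (tupleResidueCount H p : ℝ) ≤ H.card := by
    exact_mod_cast tupleResidueCount_le_card H p
  have hν0 : (0 : ℝ) ≤ tupleResidueCount H p := Nat.cast_nonneg _
  have hk' : (1 : ℝ) ≤ H.card := by exact_mod_cast hk
  have hsub : 0 < (p : ℝ) - tupleResidueCount H p := by linarith
  unfold localH
  rw [div_le_div_iff₀ hsub hp0]
  by_cases hpk : (p : ℝ) ≤ 2 * H.card
  · nlinarith
  · push Not at hpk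
    have h1 : (p : ℝ) ≤ 2 * (p - tupleResidueCount H p) := by linarith
    have h2 : (tupleResidueCount H p : ℝ) * p ≤ H.card * p :=
      mul_le_mul_of_nonneg_right hνk hp0.le
    have h3 : (H.card : ℝ) * p ≤ (H.card : ℝ) ^ 2 * (2 * (p - tupleResidueCount H p)) := by
      have : (H.card : ℝ) ≤ (H.card : ℝ) ^ 2 := by nlinarith
      calc (H.card : ℝ) * p ≤ (H.card : ℝ) ^ 2 * p := mul_le_mul_of_nonneg_right this hp0.le
        _ ≤ (H.card : ℝ) ^ 2 * (2 * (p - tupleResidueCount H p)) :=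
            mul_le_mul_of_nonneg_left h1 (by positivity)
    nlinarith [h2, h3, mul_nonneg (sq_nonneg (H.card : ℝ)) hsub.le]

/-- The coefficient bound in multiplicative form:
`|w(c)| ≤ (32 k²)^{|D(c)|} / q(c)` (`k = |H| ≥ 1`). [cite: GreenTao2006Restriction, (7.19)–(7.21)] -/
theorem norm_betaCoeff_le_div (hadm : IsAdmissibleTuple H) (hk : 1 ≤ H.card) {R : ℕ} (hR : 1 ≤ R)
    (c : Nat.primesLE R → ℕ) :
    ‖betaCoeff H R c‖ ≤ (32 * (H.card : ℝ) ^ 2) ^ (freqSupp c).card / freqDen c := by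
  refine (norm_betaCoeff_le hadm hR c).trans ?_
  rw [← Finset.prod_const, ← Finset.prod_mul_distrib]
  unfold freqDen
  push_cast
  rw [← Finset.prod_const, ← Finset.prod_div_distrib]
  refine Finset.prod_le_prod (fun p hp => ?_) fun p hp => ?_
  · exact mul_nonneg (by norm_num) (localH_nonneg (prime_of_mem_freqSupp hp).pos)
  · have hprime := prime_of_mem_freqSupp hp
    have h := localH_le hadm hk hprime
    have hp0 : (0 : ℝ) < p := by exact_mod_cast hprime.pos
    calc 8 * localH H p ≤ 8 * (4 * (H.card : ℝ) ^ 2 / p) := by gcongr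
      _ = 32 * (H.card : ℝ) ^ 2 / p := by ring

end GreenTao2006

end Literature.NumberTheory.Sieve
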